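import Literature.NumberTheory.EllipticCurves.Milne1972.WeilRestrictionQuadraticBSDQuotient
import Literature.NumberTheory.EllipticCurves.ModifiedTamagawaProduct
import HarnessLib

/-!
# The Birch–Swinnerton-Dyer quotient under quadratic base change, on an ARBITRARY `K`-model
# (Milne 1972, Thm. 1, in Dokchitser–Dokchitser's model-free form with `C(E/K) = ∏ c_v |ω/ω_v°|_v`)

Topic `NumberTheory/EllipticCurves`, story `Milne1972` (J. S. Milne, *On the arithmetic of abelian
varieties*, Invent. Math. 17 (1972) 177–190). Companion of `WeilRestrictionQuadraticBSDQuotient`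
(`Milne1972.bsdQuotient_baseChange_quadratic`), which states the same published theorem for a
GLOBALLY MINIMAL `K`-model `W'` of `E_K` (Néron differential at every finite place, so that
Dokchitser–Dokchitser's `C(E/K)` is the plain Tamagawa product). A globally minimal `K`-model exists
only when the Weierstrass class of `E_K` in `Cl(K)` is trivial; the cited statement itself has NO
such restriction: Dokchitser–Dokchitser, Ann. of Math. 172 (2010), §2.1 state the
Birch–Swinnerton-Dyer quotient for an ARBITRARY invariant differential `ω`, the dependence on `ω` of
the period term being compensated by their modified Tamagawa product
`C(E/K) = ∏_{v∤∞} c_v |ω/ω_v°|_v` (§1 "Notation", arXiv pp. 4–5: *"Fix an invariant differential `ω`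
on `E`. Let `ω_v°` be Néron differentials at finite places `v` of `K`, and set
`C(E/K) = ∏_{v∤∞} c_v |ω/ω_v°|_v`. Note that `C(E/K)` depends on the choice of `ω`"*), which the tree
DEFINES verbatim as `WeierstrassCurve.modifiedTamagawaProduct V` for the differential `ω = ω_V` of a
model `V` (`ModifiedTamagawaProduct.lean`). This file records the theorem on any `K`-model `V` of
`E_K` in that currency, for the base-change-and-descend route of the BSD rank-`≤ 1` residual cell at
additive potentially multiplicative primes (`Summits/BirchSwinnertonDyer/Rank1Residual/AdditivePotMult/`),
where `K = ℚ(√D)` ranges over quadratic fields ramified at `p` and the canonical model is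
`W.baseChange K` (not minimal at the prime above `p`).

The statement. Dokchitser–Dokchitser 2010, §2.1, statement 2.1 (after Tate) and Notation:
*"`BSD(A/K) = |Ш(A/K)| Reg(A/K) C(A/K) / (|A(K)_tors| |A^t(K)_tors| |Δ_K|^{dim A/2}) ·
∏_{v∣∞ real} ∫_{A(K_v)} |ω| · ∏_{v∣∞ cplx} 2∫_{A(K_v)} ω ∧ ω̄`. Notation. We call `BSD(A/K)` the
Birch–Swinnerton-Dyer quotient for `A/K`"*, with `Reg` the `|det|` of the canonical height pairing
on `E(K)/E(K)_tors` and the SAME `ω` in `C(A/K)` and in the archimedean integrals (so that the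
quotient does not depend on `ω`: product formula). Proof of Thm. 2.3, loc. cit.: *"write
`W_{F/K}(A)` for the Weil restriction of scalars of `A/F` to `K` … `BSD_p(W_{F/K}(A)) = BSD_p(A/F)`
provided that `Ш(A/F)[p^∞]` is finite ([24] §1)"* — [24] = Milne 1972 §1 Thm. 1 — and *"the
invariance of the Birch–Swinnerton-Dyer quotient under isogenies ([6], [35] and [25] Thm. 7.3,
Remark 7.4)"*. For `k = ℚ`, `F = K` quadratic of discriminant `D` and `A = E_K`, the Weil
restriction is `ℚ`-isogenous to `E × E^{(D)}` (Milne 1972 §2; Burungale–Flach 2024, proof of Cor. 2),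
quotients of products multiply, and the three `Ш` are simultaneously finite. Hence, for ANY model
`V` of `E_K` over `K` with differential `ω_V`:
**`#Ш(E_K)·Reg(E_K/K)·C(E_K/K, ω_V)·Ω(E_K/K, ω_V)/#E(K)_tors² = BSD(E/ℚ)·BSD(E^{(D)}/ℚ)`**.

Tree translation: `W/ℚ` globally minimal; `Wd` a globally minimal `ℚ`-model of
`W.quadraticTwist d_K` (so `BSD(E/ℚ) = W.bsdRHS`, `BSD(E^{(D)}/ℚ) = Wd.bsdRHS`, Néron differentials);
`V` any `K`-model of `W.baseChange K`; `Ω(E_K/K, ω_V) = V.bsdPeriod`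
(`∏_{w∣∞} placePeriod V w / |d_K|^{1/2}`, `ComplexPeriod.lean`, the factors of statement 2.1 for
`ω_V`); `C(E_K/K, ω_V) = V.modifiedTamagawaProduct` (`ModifiedTamagawaProduct.lean`, ∈ ℚ);
`Reg = V.regulator`, `#Ш = V.shaOrder`, `#E(K)_tors = V.torsionOrder` (model invariants). For a
globally minimal `V` every `|ω_V/ω_v°|_v = 1` and the statement is `bsdQuotient_baseChange_quadratic`.
A named fact (`def … : Prop`); users take `(h : bsdQuotient_baseChange_quadratic_anyModel)`.

## References
* J. S. Milne, *On the arithmetic of abelian varieties*, Invent. Math. 17 (1972) 177–190, §1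
  Thm. 1 (p. 182); §2 Prop. 6 (a) (p. 183), Prop. 7 (p. 184) and Example 1 (p. 185: "the
  proposition shows there is an isogeny `N_{K̄/K}A → A × A_d` of degree 4" — the Weil-restriction
  isogeny `Res_{K/ℚ} E_K ∼ E × E^{(d)}` used here). [Milne1972ArithmeticAV]
* T. Dokchitser, V. Dokchitser, *On the Birch–Swinnerton-Dyer quotients modulo squares*, Ann. of
  Math. 172 (2010) 567–596 (= arXiv:math/0610290): §1 Notation (`C(E/K)`, arXiv pp. 4–5), §2.1
  statement 2.1 and Notation (the BSD quotient), proof of Thm. 2.3. [DokchitserDokchitserAnnals2010]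
* A. Burungale, M. Flach, Camb. J. Math. 12 (2024), proof of Cor. 2 and Remark 2. [BurungaleFlach2024]
* J. S. Milne, *Arithmetic Duality Theorems*, 2nd ed., Thm. I.7.3, Remark I.7.4. [MilneADT2006]
-/

noncomputable section

open scoped Classical

namespace Literature.NumberTheory.EllipticCurves.Milne1972

open WeierstrassCurve

/-- **Milne 1972, Thm. 1 (Weil restriction) + isogeny invariance, for a quadratic base change, on
an ARBITRARY `K`-model: `#Ш(E_K)·Reg(E_K/K)·C(E_K/K,ω_V)·Ω(E_K/K,ω_V)/#E(K)_tors² =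
BSD(E/ℚ)·BSD(E^{(d_K)}/ℚ)`.** Dokchitser–Dokchitser, Ann. of Math. 172 (2010), §2.1, statement 2.1
and Notation — the Birch–Swinnerton-Dyer quotient *"`BSD(A/K) = |Ш(A/K)| Reg(A/K) C(A/K) /
(|A(K)_tors||A^t(K)_tors||Δ_K|^{dim A/2}) · ∏_{v real} ∫_{A(K_v)}|ω| · ∏_{v cplx} 2∫_{A(K_v)} ω∧ω̄`"*
for an arbitrary invariant differential `ω`, with (§1 Notation, arXiv pp. 4–5) *"`C(E/K) =
∏_{v∤∞} c_v |ω/ω_v°|_v`. Note that `C(E/K)` depends on the choice of `ω`"* — and proof of Thm. 2.3: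
*"`BSD_p(W_{F/K}(A)) = BSD_p(A/F)` provided that `Ш(A/F)[p^∞]` is finite ([24] §1)"* ([24] = Milne,
Invent. Math. 17 (1972), §1 Thm. 1) with *"the invariance of the Birch–Swinnerton-Dyer quotient under
isogenies ([6], [35] and [25] Thm. 7.3, Remark 7.4)"*; the Weil restriction of `E_K` to `ℚ` is
`ℚ`-isogenous to `E × E^{(D)}` (Milne 1972 §2; Burungale–Flach 2024, proof of Cor. 2: *"there is an
isogeny of abelian surfaces `Res^F_{F⁺}(E/F) ∼ E × E_ε`"*), quotients of products multiply, and
`Ш(E_K/K)` is finite as soon as `Ш(E/ℚ)`, `Ш(E^{(D)}/ℚ)` are (Milne *ADT* I.7.3, proof).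
Tree translation: `W` globally minimal over `ℚ`; `Wd` a globally minimal `ℚ`-model of
`W.quadraticTwist d_K`; `V` ANY `K`-model of `W.baseChange K`, with `ω = ω_V`:
`C(E_K/K, ω_V) = V.modifiedTamagawaProduct` (the tree's verbatim definition of Dokchitser–Dokchitser's
`C`, `ModifiedTamagawaProduct.lean`), `Ω(E_K/K, ω_V) = V.bsdPeriod` (`ComplexPeriod.lean`),
`Reg = V.regulator` (canonical height relative to `K`), `RHS = WeierstrassCurve.bsdRHS` over `ℚ`.
Specialises to `bsdQuotient_baseChange_quadratic` when `V` is globally minimal (all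
`|ω_V/ω_v°|_v = 1`); stated here because a globally minimal `K`-model need not exist (Weierstrass
class in `Cl(K)`). [cite: Milne1972ArithmeticAV, §1 Thm. 1; §2 Prop. 6 (a), Prop. 7 and Example 1 (p. 185) (through DokchitserDokchitserAnnals2010, §2.1, proof of Thm. 2.3)]
[cite: DokchitserDokchitserAnnals2010, §1 Notation (arXiv pp. 4–5) and §2.1: statement 2.1, Notation, proof of Thm. 2.3]
[cite: BurungaleFlach2024, proof of Cor. 2 (arXiv p. 4)] [cite: MilneADT2006, Thm. I.7.3 and Remark I.7.4] -/
def bsdQuotient_baseChange_quadratic_anyModel : Prop :=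
  ∀ (W : WeierstrassCurve ℚ) [W.IsElliptic] [W.IsGloballyMinimal]
    (K : Type) [Field K] [NumberField K], Module.finrank ℚ K = 2 →
    ∀ (Wd : WeierstrassCurve ℚ) [Wd.IsElliptic] [Wd.IsGloballyMinimal],
      (∃ C : _root_.WeierstrassCurve.VariableChange ℚ, C • W.quadraticTwist (NumberField.discr K : ℚ) = Wd) →
    ∀ (V : WeierstrassCurve K) [V.IsElliptic],
      (∃ C : _root_.WeierstrassCurve.VariableChange K, C • W.baseChange K = V) →
      W.ShaFinite → Wd.ShaFinite →
        V.ShaFinite ∧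
          (V.shaOrder : ℝ) * V.regulator * V.bsdPeriod * (V.modifiedTamagawaProduct : ℝ) /
              (V.torsionOrder : ℝ) ^ 2 =
            W.bsdRHS * Wd.bsdRHS

end Literature.NumberTheory.EllipticCurves.Milne1972

end
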